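import Literature.Topology.FourManifolds.LickorishWallace
import Literature.Topology.FourManifolds.DiffeotopyPartialTransport
import Literature.Topology.FourManifolds.IsotopyProofs
import HarnessLib

/-!
# The shell twist of a solid torus is diffeotopic to the identity (Akbulut–Ruberman 2016, §3)

Topic `Literature/Topology/FourManifolds`; written for the fact seat of
`Literature.Barriers.SmoothPoincare4.akbulutRuberman2016_symmetryKillingCobordism` (the
symmetry-killing cobordism of S. Akbulut, D. Ruberman, *Absolutely exotic compact 4-manifolds*,
Comment. Math. Helv. 91 (2016), Thm. A). In the proof of the Claim of loc. cit. §3 the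
generators of `π₀ Diff(N)` are the Dehn twists of a collar `T × [0, 1]` of a torus,
`(z, w, t) ↦ (e^{2πiat} z, e^{2πibt} w, t)`, `(a, b) ∈ ℤ ⊕ ℤ`, and the printed text continues:

> "Any such generator extends in a natural way over `S¹ × D²`. It is easy to see that the
> extension, as a diffeomorphism of `S¹ × D²`, is isotopic to the identity, via an isotopy that
> is the identity on the boundary. For example, take the disk `D²` to have radius `2`, and write
> the diffeomorphism on `S¹ × {w ∣ 1 ≤ |w| ≤ 2}`. So the extension over `S¹ × D²` is given by
> `F(z, w) = (z, w)` for `|w| ≤ 1`, `F(z, w) = (e^{2πia|w|} z, e^{2πib|w|} w)` for `1 ≤ |w| ≤ 2`.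
> Then the isotopy is given by `F_s(z, w) = (e^{2πias} z, e^{2πibs} w)` for `|w| ≤ 1`,
> `F_s(z, w) = (e^{2πias(2-|w|)} z, e^{2πibs(2-|w|)} w)` for `1 ≤ |w| ≤ 2`."

This file proves exactly this, in the smooth category and in the tree's language, and
transports it into an arbitrary manifold along a solid-torus chart:

* `Literature.Topology.FourManifolds.shellAngle w = α((‖w‖² - 1)/3)` — a smooth profile on the
  plane (`α = dehnTwistAngle` of `LickorishWallace.lean`), `0` on the unit disc and `2π` off the
  disc of radius `2` (the smooth replacement of the piecewise linear `2π|w|` of the printed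
  formula, which is only piecewise smooth);
* `Literature.Topology.FourManifolds.shellTwist a b (u, w) = (R_{a σ(w)} u, R_{b σ(w)} w)`,
  `σ = shellAngle` — **the `(a, b)` shell twist of the open solid torus `𝕊 1 × ℝ²`**: the identity
  on the core tube `‖w‖ ≤ 1` and (as `a, b ∈ ℤ`) off the tube of radius `2`, and the Dehn twist
  of the toral shell `1 ≤ ‖w‖ ≤ 2` in between (the printed `F`);
* `Literature.Topology.FourManifolds.shellTwistFamily a b t (u, w) = (R_{a t (σ(w) - 2π)} u,
  R_{b t (σ(w) - 2π)} w)` — **the printed isotopy `F_s`** (up to the direction of time, which the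
  printed formula reverses: its `F_1` is `F⁻¹`; immaterial): a jointly smooth family of
  diffeomorphisms, the identity at `t = 0`, equal to `shellTwist a b` at `t = 1`
  (`shellTwistFamily_one`, periodicity `R_{2πa} = id` for `a ∈ ℤ`), and **the identity off the
  tube of radius `2` at all times** (`shellTwistFamily_apply_of_two_le_norm`); packaged as a
  diffeotopy `shellTwistDiffeotopy a b` of `𝕊 1 × ℝ²` (`Diffeotopy.lean`) with inverse family
  `shellTwistFamily (-a) (-b)`, so that `shellTwistDiffeo a b = stage 1` is diffeotopic to the
  identity (`isDiffeotopicToId_shellTwistDiffeo`);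
* **transport** (`exists_diffeotopy_shellTwistFamily`, `isIsotopic_refl_of_shellTwist`): for a
  solid-torus chart `ψ : M ⊇ U ⇀ 𝕊 1 × ℝ²` of any manifold `M` (an open partial homeomorphism,
  `C^∞` with `C^∞` inverse, whose target contains the tube `𝕊 1 × B̄(0, 2)`), every
  self-diffeomorphism `k` of `M` which is `ψ⁻¹ ∘ shellTwist a b ∘ ψ` on `U` and the identity off
  `U` is isotopic to the identity of `M` (`Diffeomorph.IsIsotopic k (Diffeomorph.refl _ M _)`,
  the tree's isotopy relation of `Isotopy.lean`) — by the transport of compactly supported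
  diffeotopies along partial diffeomorphisms (`Diffeotopy.exists_partialTransport`,
  `DiffeotopyPartialTransport.lean`) and the elementary implications diffeotopic ⇒ ambient
  isotopic ⇒ smoothly isotopic (`IsAmbientIsotopic.isSmoothlyIsotopic_holds`).

In the proof of Thm. A this is the statement that the near-end restriction `k` of the natural
extension of a generator over the cobordism `X` — the shell twist in a tubular neighbourhood of
a component of the link `L ⊂ M` — is isotopic to `id_M`, as the extension property
`FarEndDiffeosExtend` (`ExoticContractibleTheoremAProofs.lean`) demands. Everything here is
proved; no named facts are introduced.

## References

* S. Akbulut, D. Ruberman, *Absolutely exotic compact 4-manifolds*, Comment. Math. Helv. 91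
  (2016), 1–19, §3, proof of Thm. A, proof of the Claim (the formulas `F`, `F_s`).
  [AkbulutRuberman2016]
* M. W. Hirsch, *Differential Topology*, GTM 33 (1976), Ch. 8 §1, Thms. 1.3–1.4 (extension of
  compactly supported diffeotopies by the identity). [HirschDT1976]
-/

open scoped Manifold ContDiff Topology
open Set Function Metric

noncomputable section

namespace Literature.Topology.FourManifolds

/-- Local notation: `𝔼 n` is the model Euclidean space `EuclideanSpace ℝ (Fin n)`. -/
local notation "𝔼 " n:arg => EuclideanSpace ℝ (Fin n)

/-- Local notation: `𝕊 n` is the unit sphere in `EuclideanSpace ℝ (Fin (n + 1))`. -/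
local notation "𝕊 " n:arg => (Metric.sphere (0 : EuclideanSpace ℝ (Fin (n + 1))) 1)

/-! ### Rotations of the plane (`rotateCircleAux` of `LickorishWallace.lean`) -/

/-- First coordinate of the rotated vector. [folklore] -/
@[simp]
theorem rotateCircleAux_apply_zero (θ : ℝ) (w : 𝔼 2) :
    rotateCircleAux (θ, w) 0 = Real.cos θ * w 0 - Real.sin θ * w 1 := rfl

/-- Second coordinate of the rotated vector. [folklore] -/
@[simp]
theorem rotateCircleAux_apply_one (θ : ℝ) (w : 𝔼 2) :
    rotateCircleAux (θ, w) 1 = Real.sin θ * w 0 + Real.cos θ * w 1 := rfl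

/-- Rotation of the plane through the angle `0` is the identity. [folklore] -/
@[simp]
theorem rotateCircleAux_zero (w : 𝔼 2) : rotateCircleAux (0, w) = w := by
  ext i
  fin_cases i <;> simp

/-- Rotations of the plane compose by adding angles. [folklore] -/
theorem rotateCircleAux_add (θ θ' : ℝ) (w : 𝔼 2) :
    rotateCircleAux (θ + θ', w) = rotateCircleAux (θ, rotateCircleAux (θ', w)) := by
  ext i
  fin_cases i
  · simp only [Fin.zero_eta, rotateCircleAux_apply_zero, rotateCircleAux_apply_one, Real.cos_add,
      Real.sin_add]
    ring
  · simp only [Fin.mk_one, rotateCircleAux_apply_zero, rotateCircleAux_apply_one, Real.cos_add,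
      Real.sin_add]
    ring

/-- Rotating through `θ` and then through `-θ` is the identity. [folklore] -/
@[simp]
theorem rotateCircleAux_neg_rotateCircleAux (θ : ℝ) (w : 𝔼 2) :
    rotateCircleAux (-θ, rotateCircleAux (θ, w)) = w := by
  rw [← rotateCircleAux_add, neg_add_cancel, rotateCircleAux_zero]

/-- Rotations of the plane preserve the norm. [folklore] -/
@[simp]
theorem norm_rotateCircleAux (θ : ℝ) (w : 𝔼 2) : ‖rotateCircleAux (θ, w)‖ = ‖w‖ := by
  simp only [EuclideanSpace.norm_eq, Fin.sum_univ_two, Real.norm_eq_abs, sq_abs,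
    rotateCircleAux_apply_zero, rotateCircleAux_apply_one]
  congr 1
  linear_combination (w 0 ^ 2 + w 1 ^ 2) * Real.cos_sq_add_sin_sq θ

/-- The sine of an integral multiple of `2π` vanishes. [folklore] -/
theorem sin_int_mul_two_pi (n : ℤ) : Real.sin (n * (2 * Real.pi)) = 0 := by
  have h : (n : ℝ) * (2 * Real.pi) = ((2 * n : ℤ) : ℝ) * Real.pi := by push_cast; ring
  rw [h]
  exact Real.sin_int_mul_pi _

/-- Rotation of the plane through an integral multiple of `2π` is the identity. [folklore] -/
@[simp]
theorem rotateCircleAux_int_mul_two_pi (n : ℤ) (w : 𝔼 2) :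
    rotateCircleAux (n * (2 * Real.pi), w) = w := by
  ext i
  fin_cases i <;> simp [Real.cos_int_mul_two_pi, sin_int_mul_two_pi]

/-- Rotation of the circle through an integral multiple of `2π` is the identity. [folklore] -/
@[simp]
theorem rotateCircle_int_mul_two_pi (n : ℤ) (u : 𝕊 1) :
    rotateCircle (n * (2 * Real.pi)) u = u := by
  apply Subtype.ext
  ext i
  fin_cases i <;> simp [Real.cos_int_mul_two_pi, sin_int_mul_two_pi]

/-! ### The shell profile -/

/-- **The shell profile** `σ(w) = α((‖w‖² - 1)/3)` on the plane, `α = dehnTwistAngle`: a `C^∞`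
function of `w ∈ ℝ²` depending only on `‖w‖`, equal to `0` for `‖w‖ ≤ 1` and to `2π` for
`‖w‖ ≥ 2` (smooth replacement of `2π|w|` on the shell `1 ≤ |w| ≤ 2` of the printed formula).
[cite: AkbulutRuberman2016, §3, proof of the Claim] -/
def shellAngle (w : 𝔼 2) : ℝ :=
  dehnTwistAngle ((‖w‖ ^ 2 - 1) / 3)

/-- On the unit disc the shell profile vanishes. [folklore] -/
theorem shellAngle_of_norm_le_one {w : 𝔼 2} (h : ‖w‖ ≤ 1) : shellAngle w = 0 := by
  apply dehnTwistAngle_of_nonpos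
  have : ‖w‖ ^ 2 ≤ 1 := by nlinarith [norm_nonneg w]
  linarith

/-- Off the disc of radius `2` the shell profile is the full angle `2π`. [folklore] -/
theorem shellAngle_of_two_le_norm {w : 𝔼 2} (h : 2 ≤ ‖w‖) : shellAngle w = 2 * Real.pi := by
  apply dehnTwistAngle_of_one_le
  have : 4 ≤ ‖w‖ ^ 2 := by nlinarith [norm_nonneg w]
  linarith

/-- The shell profile is `C^∞` (the squared norm is). [folklore] -/
theorem contDiff_shellAngle : ContDiff ℝ ∞ shellAngle :=
  contDiff_dehnTwistAngle.comp (((contDiff_norm_sq ℝ).sub contDiff_const).div_const _)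

/-- The shell profile is rotation invariant. [folklore] -/
@[simp]
theorem shellAngle_rotateCircleAux (θ : ℝ) (w : 𝔼 2) :
    shellAngle (rotateCircleAux (θ, w)) = shellAngle w := by
  simp [shellAngle]

/-! ### The shell twist and the isotopy `F_s` -/

/-- **The isotopy `F_s` of Akbulut–Ruberman** (smooth version, time reversed): at time `t` the
point `(u, w)` of the open solid torus `𝕊 1 × ℝ²` is rotated through `a t (σ(w) - 2π)` along the
core circle and through `b t (σ(w) - 2π)` in the meridian plane. [cite: AkbulutRuberman2016, §3, proof of the Claim (formula `F_s`)] -/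
def shellTwistFamily (a b : ℤ) (t : ℝ) (p : (𝕊 1) × 𝔼 2) : (𝕊 1) × 𝔼 2 :=
  (rotateCircle (a * (t * (shellAngle p.2 - 2 * Real.pi))) p.1,
    rotateCircleAux (b * (t * (shellAngle p.2 - 2 * Real.pi)), p.2))

/-- **The `(a, b)` shell twist** of the open solid torus `𝕊 1 × ℝ²`: `(u, w) ↦ (R_{aσ(w)} u,
R_{bσ(w)} w)` — the Dehn twist `(z, w, t) ↦ (e^{2πiat} z, e^{2πibt} w, t)` of the toral shell
`1 ≤ ‖w‖ ≤ 2` extended by the identity over the core tube and outside (the printed `F`).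
[cite: AkbulutRuberman2016, §3, proof of the Claim (formula `F`)] -/
def shellTwist (a b : ℤ) (p : (𝕊 1) × 𝔼 2) : (𝕊 1) × 𝔼 2 :=
  (rotateCircle (a * shellAngle p.2) p.1, rotateCircleAux (b * shellAngle p.2, p.2))

/-- The meridian coordinate keeps its norm under the family. [folklore] -/
@[simp]
theorem norm_shellTwistFamily_snd (a b : ℤ) (t : ℝ) (p : (𝕊 1) × 𝔼 2) :
    ‖(shellTwistFamily a b t p).2‖ = ‖p.2‖ :=
  norm_rotateCircleAux _ _

/-- The shell profile is invariant under the family. [folklore] -/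
@[simp]
theorem shellAngle_shellTwistFamily_snd (a b : ℤ) (t : ℝ) (p : (𝕊 1) × 𝔼 2) :
    shellAngle (shellTwistFamily a b t p).2 = shellAngle p.2 :=
  shellAngle_rotateCircleAux _ _

/-- The family with parameters `(-a, -b)` inverts the family with parameters `(a, b)` stagewise.
[folklore] -/
@[simp]
theorem shellTwistFamily_neg_apply (a b : ℤ) (t : ℝ) (p : (𝕊 1) × 𝔼 2) :
    shellTwistFamily (-a) (-b) t (shellTwistFamily a b t p) = p := by
  obtain ⟨u, w⟩ := p
  simp only [shellTwistFamily, shellAngle_rotateCircleAux, Int.cast_neg, neg_mul,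
    rotateCircle_neg_rotateCircle, rotateCircleAux_neg_rotateCircleAux]

/-- The family with parameters `(a, b)` inverts the family with parameters `(-a, -b)` stagewise.
[folklore] -/
@[simp]
theorem shellTwistFamily_apply_neg (a b : ℤ) (t : ℝ) (p : (𝕊 1) × 𝔼 2) :
    shellTwistFamily a b t (shellTwistFamily (-a) (-b) t p) = p := by
  simpa using shellTwistFamily_neg_apply (-a) (-b) t p

/-- At time `0` the family is the identity. [folklore] -/
theorem shellTwistFamily_zero (a b : ℤ) : shellTwistFamily a b 0 = id := by
  funext p
  obtain ⟨u, w⟩ := p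
  simp [shellTwistFamily]

/-- At time `1` the family is the shell twist (periodicity: `a, b` are integers). [folklore] -/
theorem shellTwistFamily_one (a b : ℤ) : shellTwistFamily a b 1 = shellTwist a b := by
  funext p
  obtain ⟨u, w⟩ := p
  simp only [shellTwistFamily, shellTwist, one_mul]
  have ha : (a : ℝ) * (shellAngle w - 2 * Real.pi) =
      a * shellAngle w + ((-a : ℤ) : ℝ) * (2 * Real.pi) := by
    push_cast; ring
  have hb : (b : ℝ) * (shellAngle w - 2 * Real.pi) =
      b * shellAngle w + ((-b : ℤ) : ℝ) * (2 * Real.pi) := by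
    push_cast; ring
  rw [ha, hb, rotateCircle_add, rotateCircle_int_mul_two_pi, rotateCircleAux_add,
    rotateCircleAux_int_mul_two_pi]

/-- **Support**: off the tube of radius `2` every stage of the family is the identity.
[cite: AkbulutRuberman2016, §3, proof of the Claim ("an isotopy that is the identity on the boundary")] -/
theorem shellTwistFamily_apply_of_two_le_norm (a b : ℤ) (t : ℝ) {p : (𝕊 1) × 𝔼 2}
    (h : 2 ≤ ‖p.2‖) : shellTwistFamily a b t p = p := by
  obtain ⟨u, w⟩ := p
  simp [shellTwistFamily, shellAngle_of_two_le_norm h]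

/-- On the core tube `‖w‖ ≤ 1` the shell twist is the identity. [folklore] -/
theorem shellTwist_apply_of_norm_le_one (a b : ℤ) {p : (𝕊 1) × 𝔼 2} (h : ‖p.2‖ ≤ 1) :
    shellTwist a b p = p := by
  obtain ⟨u, w⟩ := p
  simp [shellTwist, shellAngle_of_norm_le_one h]

/-- Off the tube of radius `2` the shell twist is the identity (`a, b` are integers). [folklore] -/
theorem shellTwist_apply_of_two_le_norm (a b : ℤ) {p : (𝕊 1) × 𝔼 2} (h : 2 ≤ ‖p.2‖) :
    shellTwist a b p = p := by
  rw [← shellTwistFamily_one]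
  exact shellTwistFamily_apply_of_two_le_norm a b 1 h

/-- **Joint smoothness of the family `F_s`** in `(t, u, w)` (smoothness of the rotations of the
circle and of the plane in angle and point, and of the shell profile). [folklore] -/
theorem contMDiff_shellTwistFamily (a b : ℤ) :
    ContMDiff (𝓘(ℝ, ℝ).prod ((𝓡 1).prod 𝓘(ℝ, 𝔼 2))) ((𝓡 1).prod 𝓘(ℝ, 𝔼 2)) ∞
      (uncurry (shellTwistFamily a b)) := by
  have hw : ContMDiff (𝓘(ℝ, ℝ).prod ((𝓡 1).prod 𝓘(ℝ, 𝔼 2))) 𝓘(ℝ, 𝔼 2) ∞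
      (fun q : ℝ × ((𝕊 1) × 𝔼 2) => q.2.2) := contMDiff_snd.comp contMDiff_snd
  have hu : ContMDiff (𝓘(ℝ, ℝ).prod ((𝓡 1).prod 𝓘(ℝ, 𝔼 2))) (𝓡 1) ∞
      (fun q : ℝ × ((𝕊 1) × 𝔼 2) => q.2.1) := contMDiff_fst.comp contMDiff_snd
  have hσ : ContMDiff (𝓘(ℝ, ℝ).prod ((𝓡 1).prod 𝓘(ℝ, 𝔼 2))) 𝓘(ℝ, ℝ) ∞
      (fun q : ℝ × ((𝕊 1) × 𝔼 2) => shellAngle q.2.2) := contDiff_shellAngle.comp_contMDiff hw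
  have hts : ContMDiff (𝓘(ℝ, ℝ).prod ((𝓡 1).prod 𝓘(ℝ, 𝔼 2))) 𝓘(ℝ, ℝ × ℝ) ∞
      (fun q : ℝ × ((𝕊 1) × 𝔼 2) => (q.1, shellAngle q.2.2)) := contMDiff_fst.prodMk_space hσ
  have hA : ∀ c : ℤ, ContMDiff (𝓘(ℝ, ℝ).prod ((𝓡 1).prod 𝓘(ℝ, 𝔼 2))) 𝓘(ℝ, ℝ) ∞
      (fun q : ℝ × ((𝕊 1) × 𝔼 2) => (c : ℝ) * (q.1 * (shellAngle q.2.2 - 2 * Real.pi))) := by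
    intro c
    have hc : ContDiff ℝ ∞ (fun x : ℝ × ℝ => (c : ℝ) * (x.1 * (x.2 - 2 * Real.pi))) :=
      contDiff_const.mul (contDiff_fst.mul (contDiff_snd.sub contDiff_const))
    exact hc.comp_contMDiff hts
  have hAu : ContMDiff (𝓘(ℝ, ℝ).prod ((𝓡 1).prod 𝓘(ℝ, 𝔼 2))) (𝓘(ℝ, ℝ).prod (𝓡 1)) ∞
      (fun q : ℝ × ((𝕊 1) × 𝔼 2) =>
        ((a : ℝ) * (q.1 * (shellAngle q.2.2 - 2 * Real.pi)), q.2.1)) := (hA a).prodMk hu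
  -- (elaborate the composites before comparing with the expected maps: the other order makes
  -- the unifier unfold `rotateCircle`)
  have h1' := contMDiff_rotateCircle.comp hAu
  have h1 : ContMDiff (𝓘(ℝ, ℝ).prod ((𝓡 1).prod 𝓘(ℝ, 𝔼 2))) (𝓡 1) ∞
      (fun q : ℝ × ((𝕊 1) × 𝔼 2) =>
        rotateCircle ((a : ℝ) * (q.1 * (shellAngle q.2.2 - 2 * Real.pi))) q.2.1) := h1'
  have hB : ContMDiff (𝓘(ℝ, ℝ).prod ((𝓡 1).prod 𝓘(ℝ, 𝔼 2))) 𝓘(ℝ, ℝ × 𝔼 2) ∞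
      (fun q : ℝ × ((𝕊 1) × 𝔼 2) =>
        ((b : ℝ) * (q.1 * (shellAngle q.2.2 - 2 * Real.pi)), q.2.2)) := (hA b).prodMk_space hw
  have h2' := contDiff_rotateCircleAux.comp_contMDiff hB
  have h2 : ContMDiff (𝓘(ℝ, ℝ).prod ((𝓡 1).prod 𝓘(ℝ, 𝔼 2))) 𝓘(ℝ, 𝔼 2) ∞
      (fun q : ℝ × ((𝕊 1) × 𝔼 2) =>
        rotateCircleAux ((b : ℝ) * (q.1 * (shellAngle q.2.2 - 2 * Real.pi)), q.2.2)) := h2'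
  have key := h1.prodMk h2
  exact key

/-- **The diffeotopy `F_s` of the open solid torus** from the identity to the shell twist, with
inverse family the family of parameters `(-a, -b)`. [cite: AkbulutRuberman2016, §3, proof of the Claim (formula `F_s`)] -/
def shellTwistDiffeotopy (a b : ℤ) : Diffeotopy ((𝓡 1).prod 𝓘(ℝ, 𝔼 2)) ((𝕊 1) × 𝔼 2) :=
  Diffeotopy.mk' ((𝓡 1).prod 𝓘(ℝ, 𝔼 2)) (shellTwistFamily a b) (shellTwistFamily (-a) (-b))
    (contMDiff_shellTwistFamily a b) (contMDiff_shellTwistFamily (-a) (-b))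
    (shellTwistFamily_neg_apply a b) (shellTwistFamily_apply_neg a b) (shellTwistFamily_zero a b)

/-- Stages of the shell diffeotopy (definitional). [folklore] -/
@[simp]
theorem shellTwistDiffeotopy_toFun (a b : ℤ) :
    (shellTwistDiffeotopy a b).toFun = shellTwistFamily a b := rfl

/-- Inverse stages of the shell diffeotopy (definitional). [folklore] -/
@[simp]
theorem shellTwistDiffeotopy_invFun (a b : ℤ) :
    (shellTwistDiffeotopy a b).invFun = shellTwistFamily (-a) (-b) := rfl

/-- **The shell twist as a diffeomorphism** of the open solid torus (stage `1` of `F_s`).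
[cite: AkbulutRuberman2016, §3, proof of the Claim (formula `F`)] -/
def shellTwistDiffeo (a b : ℤ) :
    ((𝕊 1) × 𝔼 2) ≃ₘ⟮(𝓡 1).prod 𝓘(ℝ, 𝔼 2), (𝓡 1).prod 𝓘(ℝ, 𝔼 2)⟯ ((𝕊 1) × 𝔼 2) :=
  (shellTwistDiffeotopy a b).stage 1

/-- The shell twist diffeomorphism is, as a function, `shellTwist a b`. [folklore] -/
@[simp]
theorem coe_shellTwistDiffeo (a b : ℤ) : ⇑(shellTwistDiffeo a b) = shellTwist a b := by
  rw [← shellTwistFamily_one]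
  rfl

/-- **The shell twist is diffeotopic to the identity** of the open solid torus (through the
compactly supported diffeotopy `F_s`). [cite: AkbulutRuberman2016, §3, proof of the Claim] -/
theorem isDiffeotopicToId_shellTwistDiffeo (a b : ℤ) :
    Diffeomorph.IsDiffeotopicToId (shellTwistDiffeo a b) :=
  ⟨shellTwistDiffeotopy a b, rfl⟩

/-- The tube of radius `2`, `𝕊 1 × B̄(0, 2)`, is compact. [folklore] -/
theorem isCompact_univ_prod_closedBall_two :
    IsCompact ((univ : Set (𝕊 1)) ×ˢ closedBall (0 : 𝔼 2) 2) :=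
  isCompact_univ.prod (isCompact_closedBall 0 2)

/-- Off the tube of radius `2` the stages of the shell diffeotopy are the identity. [folklore] -/
theorem shellTwistFamily_apply_of_not_mem (a b : ℤ) (t : ℝ) {p : (𝕊 1) × 𝔼 2}
    (hp : p ∉ (univ : Set (𝕊 1)) ×ˢ closedBall (0 : 𝔼 2) 2) : shellTwistFamily a b t p = p := by
  apply shellTwistFamily_apply_of_two_le_norm
  by_contra h
  exact hp ⟨mem_univ _, mem_closedBall_zero_iff.2 (not_le.1 h).le⟩

/-! ### Transport into a manifold along a solid-torus chart -/

section Transport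

variable {EM HM : Type*} [NormedAddCommGroup EM] [NormedSpace ℝ EM] [TopologicalSpace HM]
  {I : ModelWithCorners ℝ EM HM} {M : Type*} [TopologicalSpace M] [ChartedSpace HM M]

/-- **Transport of `F_s` along a solid-torus chart.** Let `ψ : M ⊇ U ⇀ 𝕊 1 × ℝ²` be an open
partial homeomorphism, `C^∞` with `C^∞` inverse, whose target contains the tube `𝕊 1 × B̄(0, 2)`.
Then there is a diffeotopy of `M` which is `ψ⁻¹ ∘ F_t ∘ ψ` on `U` and the identity off `U` at
all times (`Diffeotopy.exists_partialTransport`). [cite: HirschDT1976, Ch. 8 §1, Thm. 1.3] -/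
theorem exists_diffeotopy_shellTwistFamily [T2Space M]
    (ψ : OpenPartialHomeomorph M ((𝕊 1) × 𝔼 2))
    (hψ : ContMDiffOn I ((𝓡 1).prod 𝓘(ℝ, 𝔼 2)) ∞ ψ ψ.source)
    (hψ' : ContMDiffOn ((𝓡 1).prod 𝓘(ℝ, 𝔼 2)) I ∞ ψ.symm ψ.target)
    (hK : (univ : Set (𝕊 1)) ×ˢ closedBall (0 : 𝔼 2) 2 ⊆ ψ.target) (a b : ℤ) :
    ∃ D : Diffeotopy I M,
      (∀ t, ∀ x ∈ ψ.source, D.toFun t x = ψ.symm (shellTwistFamily a b t (ψ x))) ∧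
      ∀ t x, x ∉ ψ.source → D.toFun t x = x := by
  simpa using Diffeotopy.exists_partialTransport ψ hψ hψ' (shellTwistDiffeotopy a b)
    isCompact_univ_prod_closedBall_two hK
    (fun t y hy => shellTwistFamily_apply_of_not_mem a b t hy)
    (fun t y hy => shellTwistFamily_apply_of_not_mem (-a) (-b) t hy)

/-- **The transported shell twist is isotopic to the identity** (Akbulut–Ruberman's "isotopic
to the identity, via an isotopy that is the identity on the boundary", globalised): with `ψ` as
above, every self-diffeomorphism `k` of `M` which is `ψ⁻¹ ∘ shellTwist a b ∘ ψ` on the source of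
`ψ` and the identity off it is isotopic to `id_M` in the sense of `Isotopy.lean`
(`Diffeomorph.IsIsotopic`; via diffeotopic ⇒ ambient isotopic ⇒ smoothly isotopic).
[cite: AkbulutRuberman2016, §3, proof of the Claim] -/
theorem isIsotopic_refl_of_shellTwist [T2Space M] [IsManifold I ∞ M]
    (ψ : OpenPartialHomeomorph M ((𝕊 1) × 𝔼 2))
    (hψ : ContMDiffOn I ((𝓡 1).prod 𝓘(ℝ, 𝔼 2)) ∞ ψ ψ.source)
    (hψ' : ContMDiffOn ((𝓡 1).prod 𝓘(ℝ, 𝔼 2)) I ∞ ψ.symm ψ.target)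
    (hK : (univ : Set (𝕊 1)) ×ˢ closedBall (0 : 𝔼 2) 2 ⊆ ψ.target) (a b : ℤ)
    (k : M ≃ₘ⟮I, I⟯ M) (hk : ∀ x ∈ ψ.source, k x = ψ.symm (shellTwist a b (ψ x)))
    (hk' : ∀ x, x ∉ ψ.source → k x = x) :
    Diffeomorph.IsIsotopic k (Diffeomorph.refl I M ∞) := by
  obtain ⟨D, hD, hD'⟩ := exists_diffeotopy_shellTwistFamily ψ hψ hψ' hK a b
  have h1 : D.stage 1 = k := by
    refine Diffeomorph.ext fun x => ?_
    by_cases hx : x ∈ ψ.source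
    · rw [Diffeotopy.coe_stage, hD 1 x hx, hk x hx, shellTwistFamily_one]
    · rw [Diffeotopy.coe_stage, hD' 1 x hx, hk' x hx]
  have hdt : Diffeomorph.IsDiffeotopicToId k := ⟨D, h1⟩
  have hsm : IsSmoothlyIsotopic I I (id : M → M) ⇑k :=
    IsAmbientIsotopic.isSmoothlyIsotopic_holds (I := I)
      (isSmoothEmbedding_diffeomorph_holds (Diffeomorph.refl I M ∞)) hdt.isAmbientIsotopic
  exact hsm.symm

end Transport

end Literature.Topology.FourManifolds

end
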